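import Literature.NumberTheory.EllipticCurves.WeilPairingProofs
import Literature.NumberTheory.EllipticCurves.KummerUnramified
import Literature.NumberTheory.EllipticCurves.DivisionField
import Literature.NumberTheory.IwasawaTheory.ClassicalMuVanishesDivisionFieldThree
import Literature.NumberTheory.GaloisRepresentations.ArtinLFunctionDirichletProofs
import HarnessLib

/-!
# The inertia groups above `p` of the `p`-division field have every determinant:
# `det ρ̄_{E,p}(I(𝔮|p)) = 𝔽_pˣ` (Serre 1972, §5.2 (iii) read on an inertia group)

Topic `NumberTheory/EllipticCurves`; THEOREM-ONLY file (no definition, no named fact, no `sorry`), written by the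
prover seat `bsd-potss-k8t-c4` g26 (cell `bsd-potss`, `--supports stmt-BirchSwinnertonDyer-19982`).

For an elliptic curve `E/ℚ`, a prime `p` and a maximal ideal `𝔮 ∋ p` of the ring of integers of the division
field `L = ℚ(E[p]) ⊆ ℚ̄` (`W.divisionField p`), EVERY unit `u ∈ 𝔽_pˣ` is the determinant of the action on
`E[p]` of some `τ ∈ Γ_ℚ` whose restriction to `L` lies in the inertia group `I(𝔮) ≤ Gal(L/ℚ)`:

* `exists_isMaximal_comap_ringOfIntegersToIntegralClosure_eq` — lying over: every maximal ideal of `𝓞 L`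
  (`L ⊆ K̄` an intermediate field, `K` any field) is `𝔓 ∩ 𝓞 L` for a maximal ideal `𝔓` of `ℤ̄_K`
  (Mathlib `Ideal.exists_ideal_over_maximal_of_isIntegral`);
* `absRestrictNormalHom_mem_inertia_comap_of_mem_inertia` — the elementary inclusion `I_𝔓|_L ≤ I(𝔓 ∩ 𝓞 L)`;
* (private) `natGenerator_eq_of_natCast_mem` — a prime `𝔓 ∋ p` of `ℤ̄` lies above the place `p` of `ℚ`;
* `exists_mem_inertia_divisionField_det_eq` — THE STATEMENT: `∃ τ`, `τ|_L ∈ I(𝔮)` and `det M = u` for every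
  matrix `M` of `τ` in any additive frame `e : E[p] ≃ 𝔽_p²`.

Proof = composition of tree theorems: `p` is totally ramified in `ℚ(ζ_p)`, so the ABSOLUTE inertia group
`I_𝔓 ≤ Γ_ℚ` of a prime `𝔓 ⊇ 𝔮` of `ℤ̄` carries every value of the mod-`p` cyclotomic character
(`Literature.NumberTheory.GaloisRepresentations.exists_mem_inertia_modNCyclotomicCharacter_eq`, Neukirch I (10.3)–(10.4),
Serre *Local Fields* I §7 Prop. 22 (b)); `det ρ̄_{E,p} = χ̄_p` by the Weil pairing
(`WeierstrassCurve.det_eq_modPCyclotomicCharacterZMod_of_exists_weilPairing`, `exists_weilPairing_holds`, Silverman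
*AEC* III.8); and `I_𝔓` restricts into `I(𝔮)`.  Consequence used by the cell (`FineSelmerRankEqualityNonsplitCartanFiveInertia`):
`p − 1 ∣ #I(𝔮|p)`, and for a `C_ns⁺(5)` image `−1 ∈ ρ̄(I(𝔮|5))` — the displayed hypothesis `hcI` of the
rank-equality road (`CoatesSujatha2005.RankEqualityRoad.conjA_five_of_nonsplitCartanBasis_of_rankEq`) is automatic.

## References

* J.-P. Serre, *Propriétés galoisiennes des points d'ordre fini des courbes elliptiques*, Invent. Math. 15 (1972), §5.2 (iii)
  ("`det : φ_l(G) → 𝔽_lˣ` est surjectif; son image est le groupe de Galois du `l`-ième corps cyclotomique"), §1.3–1.8. [Serre1972]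
* J. Neukirch, *Algebraic Number Theory* (1999), Ch. I (10.3)–(10.4), Ch. II (7.13). [NeukirchANT1999]
* J.-P. Serre, *Local Fields*, GTM 67 (1979), Ch. I §7 Prop. 22 (b); Ch. IV §4 Prop. 17–18. [SerreLocalFields1979]
* J. H. Silverman, *The Arithmetic of Elliptic Curves*, 2nd ed. (2009), III.8 (Weil pairing). [SilvermanAEC2009]
-/

set_option autoImplicit false

noncomputable section

open scoped NumberField Matrix
open Field IntermediateField IsDedekindDomain NumberField
  Literature.NumberTheory.GaloisRepresentations Literature.NumberTheory.IwasawaTheory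

namespace Literature.NumberTheory.EllipticCurves

namespace DivisionFieldInertia

/-! ### Lying over `𝓞 L → ℤ̄_K` and the elementary inertia inclusion -/

/-- **Lying over for `𝓞 L ⊆ ℤ̄_K`.**  For an intermediate field `L` of `K̄/K` and a maximal ideal `𝔮` of `𝓞 L`
there is a maximal ideal `𝔓` of `ℤ̄_K = absIntegers (𝓞 K) K` with `𝔓 ∩ 𝓞 L = 𝔮` (along the inclusion
`ringOfIntegersToIntegralClosure L`; `ℤ̄_K` is integral over `𝓞 K`, hence over `𝓞 L`; Mathlib
`Ideal.exists_ideal_over_maximal_of_isIntegral`). [cite: NeukirchANT1999, Ch. I §9 (9.1) and Ch. I §8 (8.1)] -/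
theorem exists_isMaximal_comap_ringOfIntegersToIntegralClosure_eq {K : Type} [Field K]
    (L : IntermediateField K (AlgebraicClosure K)) (𝔮 : Ideal (𝓞 L)) [𝔮.IsMaximal] :
    ∃ 𝔓 : Ideal (absIntegers (𝓞 K) K), 𝔓.IsMaximal ∧
      𝔓.comap (ringOfIntegersToIntegralClosure (k := K) (Ω := AlgebraicClosure K) L) = 𝔮 := by
  set ι := ringOfIntegersToIntegralClosure (k := K) (Ω := AlgebraicClosure K) L with hι
  letI : Algebra (𝓞 L) (absIntegers (𝓞 K) K) := ι.toAlgebra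
  haveI : IsScalarTower (𝓞 K) (𝓞 L) (absIntegers (𝓞 K) K) :=
    IsScalarTower.of_algebraMap_eq' (ringOfIntegersToIntegralClosure_comp_algebraMap L).symm
  haveI : Algebra.IsIntegral (𝓞 L) (absIntegers (𝓞 K) K) := Algebra.IsIntegral.tower_top (𝓞 K)
  have hker : RingHom.ker (algebraMap (𝓞 L) (absIntegers (𝓞 K) K)) ≤ 𝔮 := by
    have h : RingHom.ker ι = ⊥ := (RingHom.injective_iff_ker_eq_bot _).mp (ringOfIntegersToIntegralClosure_injective L)
    change RingHom.ker ι ≤ 𝔮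
    rw [h]
    exact bot_le
  obtain ⟨𝔓, h𝔓, h𝔓𝔮⟩ := Ideal.exists_ideal_over_maximal_of_isIntegral 𝔮 hker
  exact ⟨𝔓, h𝔓, h𝔓𝔮⟩

/-- **`I_𝔓|_L ≤ I(𝔓 ∩ 𝓞 L)`** (the elementary half of Serre, *Local Fields* I §7 Prop. 22 (b)): for `L ⊆ K̄` normal
over `K` and `τ` in the absolute inertia group of a prime `𝔓` of `ℤ̄_K`, the restriction `τ|_L` lies in the
inertia group of `𝔓 ∩ 𝓞 L` in `Gal(L/K)`. [cite: SerreLocalFields1979, Ch. I §7 Prop. 22(b)] -/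
theorem absRestrictNormalHom_mem_inertia_comap_of_mem_inertia {K : Type} [Field K]
    (L : IntermediateField K (AlgebraicClosure K)) [Normal K L] (𝔓 : Ideal (absIntegers (𝓞 K) K))
    {τ : absoluteGaloisGroup K} (hτ : τ ∈ 𝔓.inertia (absoluteGaloisGroup K)) :
    absRestrictNormalHom L τ ∈
      (𝔓.comap (ringOfIntegersToIntegralClosure (k := K) (Ω := AlgebraicClosure K) L)).inertia (L ≃ₐ[K] L) := by
  set ι := ringOfIntegersToIntegralClosure (k := K) (Ω := AlgebraicClosure K) L with hι
  intro y
  have h1 : ι (absRestrictNormalHom L τ • y) = τ • ι y := by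
    apply Subtype.ext
    rw [integralClosure.coe_smul, coe_ringOfIntegersToIntegralClosure, coe_ringOfIntegersToIntegralClosure]
    exact AlgEquiv.restrictNormalHom_apply L _ y
  change ι (absRestrictNormalHom L τ • y - y) ∈ 𝔓
  rw [map_sub, h1]
  exact hτ (ι y)

/-! ### A prime of `ℤ̄` containing `p` lies above the place `p` -/

/-- If a proper ideal `𝔓` of `ℤ̄ = absIntegers (𝓞 ℚ) ℚ` lying above the finite place `v` of `ℚ` contains the rational
prime `p`, then `p` is the prime under `v` (`natGenerator v = p`): two distinct rational primes are comaximal.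
[folklore] -/
private theorem natGenerator_eq_of_natCast_mem {v : HeightOneSpectrum (𝓞 ℚ)} {𝔓 : Ideal (absIntegers (𝓞 ℚ) ℚ)}
    (h𝔓 : 𝔓 ∈ v.primesAbove) {p : ℕ} (hp : p.Prime) (hp𝔓 : ((p : ℕ) : absIntegers (𝓞 ℚ) ℚ) ∈ 𝔓) :
    Rat.HeightOneSpectrum.natGenerator v = p := by
  haveI := h𝔓.1
  by_contra hne
  have hq := Rat.HeightOneSpectrum.prime_natGenerator v
  have hcop : Nat.Coprime (Rat.HeightOneSpectrum.natGenerator v) p :=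
    (Nat.coprime_primes hq hp).mpr hne
  obtain ⟨a, b, hab⟩ := Nat.isCoprime_iff_coprime.mpr hcop
  have h1 : (1 : absIntegers (𝓞 ℚ) ℚ) ∈ 𝔓 := by
    have hmem : (a : absIntegers (𝓞 ℚ) ℚ) * (Rat.HeightOneSpectrum.natGenerator v : ℕ) +
        (b : absIntegers (𝓞 ℚ) ℚ) * (p : ℕ) ∈ 𝔓 :=
      𝔓.add_mem (𝔓.mul_mem_left _ (Rat.natCast_natGenerator_mem_of_mem_primesAbove h𝔓))
        (𝔓.mul_mem_left _ hp𝔓)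
    have hcast : ((a * (Rat.HeightOneSpectrum.natGenerator v : ℕ) + b * (p : ℕ) : ℤ) : absIntegers (𝓞 ℚ) ℚ) =
        (a : absIntegers (𝓞 ℚ) ℚ) * (Rat.HeightOneSpectrum.natGenerator v : ℕ) + (b : absIntegers (𝓞 ℚ) ℚ) * (p : ℕ) := by
      push_cast
      ring
    rw [← hcast, hab, Int.cast_one] at hmem
    exact hmem
  exact (Ideal.IsPrime.ne_top inferInstance) ((Ideal.eq_top_iff_one _).mpr h1)

/-- Every maximal ideal of `ℤ̄` lies above some finite place of `ℚ` (restatement of the tree's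
`exists_mem_primesAbove_of_isMaximal` of `SerreOpenImageAssemblyProofs`, reproved here to keep the imports light).
[folklore] -/
private theorem exists_mem_primesAbove_of_isMaximal' (𝔓 : Ideal (absIntegers (𝓞 ℚ) ℚ)) [h𝔓 : 𝔓.IsMaximal] :
    ∃ v : HeightOneSpectrum (𝓞 ℚ), 𝔓 ∈ v.primesAbove := by
  haveI : (𝔓.under (𝓞 ℚ)).IsMaximal := Ideal.IsMaximal.under (𝓞 ℚ) 𝔓
  have hne : 𝔓.under (𝓞 ℚ) ≠ ⊥ :=
    Ring.ne_bot_of_isMaximal_of_not_isField inferInstance (RingOfIntegers.not_isField ℚ)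
  exact ⟨⟨𝔓.under (𝓞 ℚ), inferInstance, hne⟩, h𝔓.isPrime, ⟨rfl⟩⟩

/-! ### The statement -/

/-- **`det ρ̄_{E,p}(I(𝔮|p)) = 𝔽_pˣ`.**  `E/ℚ` elliptic, `p` a prime, `L = ℚ(E[p]) ⊆ ℚ̄`, `𝔮 ∋ p` a maximal ideal of
`𝓞 L`, `u ∈ 𝔽_pˣ`.  Then some `τ ∈ Γ_ℚ` restricts into the inertia group `I(𝔮) ≤ Gal(L/ℚ)` and acts on `E[p]`, in
any additive frame `e : E[p] ≃+ 𝔽_p²`, through a matrix of determinant `u`.  Composition of: lying over (`𝔮 = 𝔓 ∩ 𝓞 L`),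
`χ̄_p(I_𝔓) = 𝔽_pˣ` (`exists_mem_inertia_modNCyclotomicCharacter_eq`: `ℚ(ζ_p)/ℚ` is totally ramified at `p`),
`det ρ̄_{E,p} = χ̄_p` (Weil pairing), `I_𝔓|_L ≤ I(𝔮)`. [cite: Serre1972, §5.2 (iii)]
[cite: NeukirchANT1999, Ch. I (10.3)–(10.4)] [cite: SilvermanAEC2009, Prop. III.8.1 and §III.8] -/
theorem exists_mem_inertia_divisionField_det_eq (W : WeierstrassCurve ℚ) [W.IsElliptic] (p : ℕ) [Fact p.Prime]
    (e : W.geomTorsion (p : ℕ) ≃+ (Fin 2 → ZMod p))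
    (𝔮 : Ideal (𝓞 ↥(W.divisionField p))) [𝔮.IsMaximal] (h𝔮 : ((p : ℕ) : 𝓞 ↥(W.divisionField p)) ∈ 𝔮)
    (u : (ZMod p)ˣ) :
    ∃ τ : absoluteGaloisGroup ℚ,
      absRestrictNormalHom (W.divisionField p) τ ∈ 𝔮.inertia (↥(W.divisionField p) ≃ₐ[ℚ] ↥(W.divisionField p)) ∧
      ∀ M : Matrix (Fin 2) (Fin 2) (ZMod p), (∀ P : W.geomTorsion (p : ℕ), e (τ • P) = M *ᵥ e P) → M.det = (u : ZMod p) := by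
  have hp : p.Prime := Fact.out
  -- lying over: `𝔮 = 𝔓 ∩ 𝓞 L`
  obtain ⟨𝔓, h𝔓max, h𝔓𝔮⟩ := exists_isMaximal_comap_ringOfIntegersToIntegralClosure_eq (W.divisionField p) 𝔮
  -- `p ∈ 𝔓`, so `𝔓` lies above the place `p` of `ℚ`
  have hp𝔓 : ((p : ℕ) : absIntegers (𝓞 ℚ) ℚ) ∈ 𝔓 := by
    have h : (p : 𝓞 ↥(W.divisionField p)) ∈
        𝔓.comap (ringOfIntegersToIntegralClosure (k := ℚ) (Ω := AlgebraicClosure ℚ) (W.divisionField p)) := by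
      rw [h𝔓𝔮]; exact h𝔮
    have e1 : ringOfIntegersToIntegralClosure (k := ℚ) (Ω := AlgebraicClosure ℚ) (W.divisionField p)
        (p : 𝓞 ↥(W.divisionField p)) = (p : absIntegers (𝓞 ℚ) ℚ) := map_natCast _ p
    have h' := Ideal.mem_comap.mp h
    exact (congrArg (· ∈ 𝔓) e1).mp h'
  obtain ⟨v, hv𝔓⟩ := exists_mem_primesAbove_of_isMaximal' 𝔓
  have hv : Rat.HeightOneSpectrum.natGenerator v = p := natGenerator_eq_of_natCast_mem hv𝔓 hp hp𝔓
  -- an absolute inertia element with cyclotomic character `u`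
  obtain ⟨τ, hτI, hτu⟩ := exists_mem_inertia_modNCyclotomicCharacter_eq (m := p) (p := p) (k := 0) (d := 1)
    (by rw [zero_add, pow_one, mul_one]) hp.not_dvd_one hv hv𝔓 (a := u) (Subsingleton.elim _ _)
  refine ⟨τ, ?_, fun M hM => ?_⟩
  · rw [← h𝔓𝔮]
    exact absRestrictNormalHom_mem_inertia_comap_of_mem_inertia (W.divisionField p) 𝔓 hτI
  · rw [WeierstrassCurve.det_eq_modPCyclotomicCharacterZMod_of_exists_weilPairing W p
      (WeierstrassCurve.exists_weilPairing_holds W p) e τ M hM,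
      modPCyclotomicCharacterZMod_eq_modNCyclotomicCharacter, hτu]

/-- **Corollary: `I(𝔮|p)` contains an element of any prescribed determinant** — the form consumed downstream: given
a faithful matrix representation `ρ` of `Gal(ℚ(E[p])/ℚ)` in the frame `e` (`exists_matrixRep_divisionField`), for every
maximal `𝔮 ∋ p` of `𝓞 ℚ(E[p])` and `u ∈ 𝔽_pˣ` there is `g ∈ I(𝔮)` with `det ρ(g) = u`. [cite: Serre1972, §5.2 (iii)] -/
theorem exists_mem_inertia_divisionField_det_rep_eq (W : WeierstrassCurve ℚ) [W.IsElliptic] (p : ℕ) [Fact p.Prime]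
    (e : W.geomTorsion (p : ℕ) ≃+ (Fin 2 → ZMod p))
    (ρ : (↥(W.divisionField p) ≃ₐ[ℚ] ↥(W.divisionField p)) →* Matrix (Fin 2) (Fin 2) (ZMod p))
    (hρe : ∀ (σ : absoluteGaloisGroup ℚ) (P : W.geomTorsion (p : ℕ)),
      e (σ • P) = ρ (absRestrictNormalHom (W.divisionField p) σ) *ᵥ e P)
    (𝔮 : Ideal (𝓞 ↥(W.divisionField p))) [𝔮.IsMaximal] (h𝔮 : ((p : ℕ) : 𝓞 ↥(W.divisionField p)) ∈ 𝔮)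
    (u : (ZMod p)ˣ) :
    ∃ g ∈ 𝔮.inertia (↥(W.divisionField p) ≃ₐ[ℚ] ↥(W.divisionField p)), (ρ g).det = (u : ZMod p) := by
  obtain ⟨τ, hτ, hdet⟩ := exists_mem_inertia_divisionField_det_eq W p e 𝔮 h𝔮 u
  exact ⟨absRestrictNormalHom (W.divisionField p) τ, hτ, hdet _ (hρe τ)⟩

/-! ### Corollary: `p − 1` divides the order of every inertia group above `p` -/

/-- **`p − 1 ∣ #I(𝔮|p)` in `Gal(ℚ(E[p])/ℚ)`** — the ramification index of `p` in the `p`-division field is divisible by `p − 1` (the inertia group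
maps ONTO `𝔽_pˣ` under `det ∘ ρ̄_{E,p} = χ̄_p`, `exists_mem_inertia_divisionField_det_rep_eq`; Mathlib `Subgroup.card_dvd_of_surjective`,
`ZMod.card_units`).  Equivalently `ℚ(ζ_p) ⊆ ℚ(E[p])` is totally ramified at `p`. [cite: Serre1972, §5.2 (iii)] [cite: SilvermanAEC2009, §III.8 (Cor. 8.1.1)] -/
theorem sub_one_dvd_card_inertia_divisionField (W : WeierstrassCurve ℚ) [W.IsElliptic] (p : ℕ) [Fact p.Prime]
    (e : W.geomTorsion (p : ℕ) ≃+ (Fin 2 → ZMod p))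
    (𝔮 : Ideal (𝓞 ↥(W.divisionField p))) [𝔮.IsMaximal] (h𝔮 : ((p : ℕ) : 𝓞 ↥(W.divisionField p)) ∈ 𝔮) :
    (p - 1) ∣ Nat.card ↥(𝔮.inertia (↥(W.divisionField p) ≃ₐ[ℚ] ↥(W.divisionField p))) := by
  classical
  haveI : NeZero p := ⟨(Fact.out : p.Prime).ne_zero⟩
  obtain ⟨ρm, -, hρme⟩ := exists_matrixRep_divisionField W p e
  set I := 𝔮.inertia (↥(W.divisionField p) ≃ₐ[ℚ] ↥(W.divisionField p)) with hI
  -- `det ∘ ρ` on `I`, valued in the units of `𝔽_p`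
  let φ : ↥I →* (ZMod p)ˣ := (Units.map (Matrix.detMonoidHom : Matrix (Fin 2) (Fin 2) (ZMod p) →* ZMod p)).comp
    ((ρm.comp I.subtype).toHomUnits)
  have hφ : ∀ g : ↥I, ((φ g : (ZMod p)ˣ) : ZMod p) = (ρm (g : ↥(W.divisionField p) ≃ₐ[ℚ] ↥(W.divisionField p))).det := fun g => rfl
  have hsurj : Function.Surjective φ := fun u => by
    obtain ⟨g, hgI, hgdet⟩ := exists_mem_inertia_divisionField_det_rep_eq W p e ρm hρme 𝔮 h𝔮 u
    exact ⟨⟨g, hgI⟩, Units.ext (by rw [hφ]; exact hgdet)⟩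
  have h := Subgroup.card_dvd_of_surjective φ hsurj
  rwa [Nat.card_eq_fintype_card, ZMod.card_units] at h

end DivisionFieldInertia

end Literature.NumberTheory.EllipticCurves

end
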